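import Summits.RiemannHypothesis.RiemannHypothesis.Theorems.SuzukiThetaFlowFormDomain

/-!
# WeilFormIdentityOnDomain — Weil's quadratic functional IS the Connes–Consani extended form on the whole form domain
# (column DBR; RH-FREE)

LINE 1 — LABEL: RH-FREE Fourier analysis (no sign of any form is asserted); bears_on LADDER-RH B-P(P2-flow) (theory g10's
by-product K-B `FormIdentityOnDomain` of the round-2 rung `ThetaFlowDecay`, HOME/rh-dbr-theory/round2/v2/bc/
FormIdentityOnDomain_birth.lean, statement verbatim).  WHAT THIS IS NOT: not a positivity statement, not a statement about
zeros; nothing here bears on the truth of RH.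

THE STATEMENT.  For every window `a > 0` and every `ξ` in the Connes–Consani form domain
`formDomain a = {ξ ∈ L², supp ξ ⊆ [−a,a], ∫|ξ̂(½+it)|²(1+log(1+t²)) dt < ∞}` ([CC23] §2, Prop. 2.1 / Lemma 2.2),

  `Re Q(ξ) = E_{⌊e^{2a}⌋}(ξ)`,

`Q = weilQuadratic` (Weil's `W(ξ ⋆ ξ̃)`, Bombieri's normalisation) and `E_N = weilFinitePrimeQuadratic N` (Yoshida's analytic
form).  Hence CC's lower-semicontinuous extended form `semilocalWeilForm a` — DEFINED as `E_N` on the domain and `+∞` off it —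
coincides with Weil's functional wherever it is finite (`semilocalWeilForm_eq_re_weilQuadratic_of_mem_formDomain`): the
`L²`-extension of [CC23] Prop. 2.1 is not a new object.  The tree had this on SMOOTH tests only
(`weilQuadratic_eq_weilFinitePrimeQuadratic`, `semilocalWeilForm_eq_re_weilQuadratic`).

PROOF.  `Theorems/SuzukiOutputsWeilForm.weilQuadratic_eq_weilFinitePrimeQuadratic_of_rough` ([rh-dbr-eng] g7, p472628) proves
the identity for every `g ∈ L¹ ∩ L²` with `tsupport g ⊆ [−a,a]` whose autocorrelation `g ⋆ g̃` is continuous and whose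
archimedean integrand `|ĝ(½+it)|²·Re ψ(¼+it/2)` is integrable.  On the form domain: (i) the AUTOCORRELATION OF ANY `L²`
FUNCTION IS CONTINUOUS (`continuous_autocorr_of_memLp`: continuous compactly supported functions are dense in `L²`
(`MemLp.exists_hasCompactSupport_eLpNorm_sub_le`), their autocorrelations are continuous, and
`‖φ_ξ − φ_η‖_∞ ≤ ‖ξ−η‖₂(‖ξ‖₂+‖η‖₂)` by Cauchy–Schwarz, so `φ_ξ` is a uniform limit of continuous functions);
(ii) `|ξ̂|²·Re ψ ∈ L¹` from finite energy, since `|Re ψ(¼+it/2)| ≤ K(1+log(1+t²))`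
(`exists_reDigammaQuarter_sub_le_logWeight`, `SuzukiFlowPairing.re_digamma_quarter_le`).

COROLLARIES (RH-FREE): `weilQuadratic_im_of_mem_formDomain` (`Q(ξ)` is real on the domain); for the θ-flow window outputs
`g_θ = winOut θ t f` (in the domain by `winOut_mem_formDomain`, rh-dbr-eng-5 g6 p475212): `semilocalWeilForm_winOut`
and the DISSIPATION IDENTITY IN CC LANGUAGE `hasDerivAt_winNormSq_semilocal`:
`d/dθ ‖𝖪_θ[t]f‖² = −2·E_{⌊e^{2t}⌋}(g_θ)` (from `thetaFlowIdentity`, [rh-dbr-eng] g6 p467098).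

References: A. Weil (1952); E. Bombieri, Rend. Lincei (9) 11 (2000) Thm 2, §2; H. Yoshida, ASPM 21 (1992) §2 (2.1);
[CC23] A. Connes, C. Consani, Enseign. Math. 69 (2023) §2, Prop. 2.1, Lemma 2.2.
-/

noncomputable section

-- D-0017: `Summit.<S>.<S>.…` is the designed namespace of a single-problem summit.
set_option linter.dupNamespace false

open Complex MeasureTheory Set Filter Topology
open scoped Real ComplexConjugate ENNReal

namespace Summit.RiemannHypothesis.RiemannHypothesis.Theorems.SuzukiThetaFlow

open Literature.NumberTheory.LFunctions Literature.NumberTheory.ConnesConsani2023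
open Literature.Analysis.SpecialFunctions (reDigammaQuarter measurable_reDigammaQuarter)
open Summit.RiemannHypothesis.RiemannHypothesis.Theorems

/-! ## §1 The archimedean weight against a function of finite energy -/

variable {ξ : ℝ → ℂ} {a : ℝ}

/-- RH-FREE.  Two-sided comparison of the archimedean weight with the log weight:
`|Re ψ(¼+it/2)| ≤ K(1 + log(1+t²))` (upper side `exists_reDigammaQuarter_sub_le_logWeight`, lower side
`Re ψ(¼) ≤ Re ψ(¼+it/2)`). -/
theorem exists_abs_reDigammaQuarter_le_logWeight :
    ∃ K : ℝ, 0 < K ∧ ∀ t : ℝ, |reDigammaQuarter t| ≤ K * (1 + Real.log (1 + t ^ 2)) := by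
  obtain ⟨K, hK, hKb⟩ := exists_reDigammaQuarter_sub_le_logWeight
  refine ⟨K + |reDigammaQuarter 0|, by positivity, fun t ↦ ?_⟩
  have hL : 0 ≤ Real.log (1 + t ^ 2) := Real.log_nonneg (by nlinarith [sq_nonneg t])
  have hlow : reDigammaQuarter 0 ≤ reDigammaQuarter t := by
    have h := SuzukiFlowPairing.re_digamma_quarter_le t
    have e : (1 / 4 + ((0 : ℝ) : ℂ) / 2 * I) = (((1 / 4 : ℝ)) : ℂ) := by push_cast; ring
    unfold reDigammaQuarter
    rw [e]
    exact h
  have hup := hKb t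
  rw [abs_le]
  constructor
  · nlinarith [neg_abs_le (reDigammaQuarter 0), abs_nonneg (reDigammaQuarter 0)]
  · nlinarith [le_abs_self (reDigammaQuarter 0), abs_nonneg (reDigammaQuarter 0)]

/-- RH-FREE.  Finite log-Sobolev energy, read as a Bochner integrability statement:
`t ↦ |ξ̂(½+it)|²(1 + log(1+t²)) ∈ L¹` for `ξ ∈ L¹` with `logSobolevEnergy ξ < ∞`. -/
theorem integrable_norm_sq_weilMellin_mul_logWeight_of_energy (h1 : Integrable ξ)
    (hE : logSobolevEnergy ξ < ∞) :
    Integrable fun t : ℝ ↦ ‖weilMellin ξ (1 / 2 + t * I)‖ ^ 2 * (1 + Real.log (1 + t ^ 2)) := by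
  have hmeas : AEStronglyMeasurable
      (fun t : ℝ ↦ ‖weilMellin ξ (1 / 2 + t * I)‖ ^ 2 * (1 + Real.log (1 + t ^ 2))) volume := by
    have hc := continuous_weilMellin_half_line_of_integrable h1
    exact ((hc.norm.pow 2).measurable.mul
      (measurable_const.add ((measurable_const.add (measurable_id.pow_const 2)).log))).aestronglyMeasurable
  refine ⟨hmeas, ?_⟩
  rw [hasFiniteIntegral_iff_ofReal (Eventually.of_forall fun t ↦ mul_nonneg (by positivity)
    (by have : 0 ≤ Real.log (1 + t ^ 2) := Real.log_nonneg (by nlinarith [sq_nonneg t]); linarith))]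
  exact hE

/-- RH-FREE.  **On the form domain the archimedean integrand is integrable**: `t ↦ |ξ̂(½+it)|² Re ψ(¼+it/2) ∈ L¹`
for `ξ ∈ L¹` of finite energy. -/
theorem integrable_norm_sq_weilMellin_mul_reDigammaQuarter_of_energy (h1 : Integrable ξ)
    (hE : logSobolevEnergy ξ < ∞) :
    Integrable fun t : ℝ ↦ ‖weilMellin ξ (1 / 2 + t * I)‖ ^ 2 * reDigammaQuarter t := by
  obtain ⟨K, hK, hKb⟩ := exists_abs_reDigammaQuarter_le_logWeight
  have hlog := integrable_norm_sq_weilMellin_mul_logWeight_of_energy h1 hE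
  have hmeas : AEStronglyMeasurable (fun t : ℝ ↦ ‖weilMellin ξ (1 / 2 + t * I)‖ ^ 2 * reDigammaQuarter t) volume := by
    have hc := continuous_weilMellin_half_line_of_integrable h1
    exact ((hc.norm.pow 2).measurable.mul measurable_reDigammaQuarter).aestronglyMeasurable
  refine (hlog.const_mul K).mono' hmeas (Eventually.of_forall fun t ↦ ?_)
  rw [norm_mul, Real.norm_eq_abs, Real.norm_eq_abs, abs_of_nonneg (by positivity : (0 : ℝ) ≤ ‖weilMellin ξ (1 / 2 + t * I)‖ ^ 2)]
  calc ‖weilMellin ξ (1 / 2 + t * I)‖ ^ 2 * |reDigammaQuarter t|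
      ≤ ‖weilMellin ξ (1 / 2 + t * I)‖ ^ 2 * (K * (1 + Real.log (1 + t ^ 2))) :=
        mul_le_mul_of_nonneg_left (hKb t) (by positivity)
    _ = K * (‖weilMellin ξ (1 / 2 + t * I)‖ ^ 2 * (1 + Real.log (1 + t ^ 2))) := by ring

/-! ## §2 The autocorrelation of an `L²` function is continuous -/

/-- RH-FREE.  The autocorrelation written out: `(ξ ⋆ ξ̃)(x) = ∫ ξ(u) conj ξ(u − x) du`. -/
theorem autocorr_apply (ξ : ℝ → ℂ) (x : ℝ) :
    weilConv ξ (weilReflect ξ) x = ∫ u, ξ u * conj (ξ (u - x)) := by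
  rw [weilConv_apply]
  congr 1 with u
  simp only [weilReflect, neg_sub]

/-- RH-FREE.  A translate of an `L²` function is `L²` with the same norm. -/
theorem memLp_comp_sub_right (h2 : MemLp ξ 2 volume) (x : ℝ) : MemLp (fun u ↦ ξ (u - x)) 2 volume :=
  h2.comp_measurePreserving (measurePreserving_sub_right volume x)

/-- RH-FREE.  Cauchy–Schwarz for the pairing `∫ f(u) conj g(u − x) du` of two `L²` functions:
`‖∫ f · conj g(· − x)‖ ≤ ‖f‖₂ ‖g‖₂`. -/
theorem norm_integral_mul_conj_shift_le {f g : ℝ → ℂ} (hf : MemLp f 2 volume) (hg : MemLp g 2 volume) (x : ℝ) :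
    ‖∫ u, f u * conj (g (u - x))‖ ≤ Real.sqrt (∫ u, ‖f u‖ ^ 2) * Real.sqrt (∫ u, ‖g u‖ ^ 2) := by
  have hgx : MemLp (fun u ↦ conj (g (u - x))) 2 volume := by
    have h := memLp_comp_sub_right hg x
    exact h.of_le (Complex.continuous_conj.comp_aestronglyMeasurable h.1) (Eventually.of_forall fun u ↦ by simp)
  have h2 : ENNReal.ofReal 2 = (2 : ℝ≥0∞) := by norm_num
  have hf' : MemLp f (ENNReal.ofReal 2) volume := by rwa [h2]
  have hg' : MemLp (fun u ↦ conj (g (u - x))) (ENNReal.ofReal 2) volume := by rwa [h2]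
  have hH := integral_mul_norm_le_Lp_mul_Lq (μ := volume) Real.HolderConjugate.two_two hf' hg'
  have htrans : ∫ u, ‖conj (g (u - x))‖ ^ (2 : ℝ) = ∫ u, ‖g u‖ ^ (2 : ℝ) := by
    have e : (fun u : ℝ ↦ ‖conj (g (u - x))‖ ^ (2 : ℝ)) = fun u ↦ (fun v ↦ ‖g v‖ ^ (2 : ℝ)) (u - x) := by
      funext u; simp
    rw [e, integral_sub_right_eq_self (μ := volume) (fun v ↦ ‖g v‖ ^ (2 : ℝ)) x]
  rw [htrans] at hH
  simp_rw [Real.rpow_two] at hH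
  rw [← Real.sqrt_eq_rpow, ← Real.sqrt_eq_rpow] at hH
  refine (norm_integral_le_integral_norm _).trans (le_trans (le_of_eq ?_) hH)
  congr 1 with u
  rw [norm_mul]

/-- RH-FREE.  **Uniform comparison of two autocorrelations**:
`‖φ_ξ(x) − φ_η(x)‖ ≤ ‖ξ−η‖₂ (‖ξ‖₂ + ‖η‖₂)` for every `x` (`φ_ξ = ξ ⋆ ξ̃`). -/
theorem norm_autocorr_sub_autocorr_le {η : ℝ → ℂ} (hξ : MemLp ξ 2 volume) (hη : MemLp η 2 volume) (x : ℝ) :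
    ‖weilConv ξ (weilReflect ξ) x - weilConv η (weilReflect η) x‖ ≤
      Real.sqrt (∫ u, ‖ξ u - η u‖ ^ 2) * (Real.sqrt (∫ u, ‖ξ u‖ ^ 2) + Real.sqrt (∫ u, ‖η u‖ ^ 2)) := by
  have hd : MemLp (fun u ↦ ξ u - η u) 2 volume := hξ.sub hη
  -- integrability of the four pairings
  have hI : ∀ {f g : ℝ → ℂ}, MemLp f 2 volume → MemLp g 2 volume →
      Integrable (fun u ↦ f u * conj (g (u - x))) := by
    intro f g hf hg
    have hgx : MemLp (fun u ↦ conj (g (u - x))) 2 volume := by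
      have h := memLp_comp_sub_right hg x
      exact h.of_le (Complex.continuous_conj.comp_aestronglyMeasurable h.1) (Eventually.of_forall fun u ↦ by simp)
    exact hf.integrable_mul hgx
  rw [autocorr_apply, autocorr_apply]
  have hsplit : (∫ u, ξ u * conj (ξ (u - x))) - ∫ u, η u * conj (η (u - x)) =
      (∫ u, (ξ u - η u) * conj (ξ (u - x))) + ∫ u, η u * conj ((fun v ↦ ξ v - η v) (u - x)) := by
    rw [← integral_sub (hI hξ hξ) (hI hη hη), ← integral_add (hI hd hξ) (hI hη hd)]
    congr 1 with u
    simp only [map_sub]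
    ring
  rw [hsplit]
  refine (norm_add_le _ _).trans ?_
  have h1 := norm_integral_mul_conj_shift_le hd hξ x
  have h2 := norm_integral_mul_conj_shift_le hη hd x
  have hA : 0 ≤ Real.sqrt (∫ u, ‖ξ u - η u‖ ^ 2) := Real.sqrt_nonneg _
  nlinarith [h1, h2, hA, Real.sqrt_nonneg (∫ u, ‖η u‖ ^ 2)]

/-- RH-FREE.  The autocorrelation of a continuous compactly supported function is continuous. -/
theorem continuous_autocorr_of_continuous {η : ℝ → ℂ} (hc : Continuous η) (hs : HasCompactSupport η) :
    Continuous (weilConv η (weilReflect η)) := by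
  unfold weilConv
  have hrc : Continuous (weilReflect η) := by
    unfold weilReflect; exact Complex.continuous_conj.comp (hc.comp continuous_neg)
  have hrs : HasCompactSupport (weilReflect η) := hasCompactSupport_weilReflect hs
  exact hrs.continuous_convolution_right (L := ContinuousLinearMap.mul ℂ ℂ) hc.locallyIntegrable hrc

/-- **RH-FREE · THE AUTOCORRELATION OF AN `L²` FUNCTION IS CONTINUOUS.**  `x ↦ (ξ ⋆ ξ̃)(x) = ∫ ξ(u) conj ξ(u−x) du`
is continuous on `ℝ` for every `ξ ∈ L²(ℝ)`: a uniform limit of the (continuous) autocorrelations of continuous compactly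
supported approximants. -/
theorem continuous_autocorr_of_memLp (hξ : MemLp ξ 2 volume) : Continuous (weilConv ξ (weilReflect ξ)) := by
  refine continuous_of_uniform_approx_of_continuous fun u hu ↦ ?_
  obtain ⟨ε, hε, hεu⟩ := Metric.mem_uniformity_dist.1 hu
  set A : ℝ := Real.sqrt (∫ v, ‖ξ v‖ ^ 2) with hA
  have hA0 : 0 ≤ A := Real.sqrt_nonneg _
  -- choose δ with δ (2A + δ) < ε
  set δ : ℝ := min 1 (ε / (2 * A + 2)) with hδ
  have hδ0 : 0 < δ := lt_min one_pos (by positivity)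
  have hδ1 : δ ≤ 1 := min_le_left _ _
  have hδ2 : δ ≤ ε / (2 * A + 2) := min_le_right _ _
  have hδε : δ * (2 * A + δ) < ε := by
    have h1 : δ * (2 * A + δ) ≤ δ * (2 * A + 1) := by nlinarith
    have h2 : δ * (2 * A + 1) < δ * (2 * A + 2) := by nlinarith
    have h3 : δ * (2 * A + 2) ≤ ε := by
      rw [le_div_iff₀ (by positivity)] at hδ2; linarith
    linarith
  -- an approximant with `‖ξ − η‖₂ ≤ δ`
  have hξ' : MemLp ξ (ENNReal.ofReal 2) volume := by
    rwa [show ENNReal.ofReal 2 = (2 : ℝ≥0∞) by norm_num]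
  obtain ⟨η, hηs, hηε, hηc, hη2⟩ :=
    hξ'.exists_hasCompactSupport_integral_rpow_sub_le two_pos (ε := δ ^ 2) (by positivity)
  have hη2' : MemLp η 2 volume := by rwa [show ENNReal.ofReal 2 = (2 : ℝ≥0∞) by norm_num] at hη2
  simp_rw [Real.rpow_two] at hηε
  refine ⟨weilConv η (weilReflect η), continuous_autocorr_of_continuous hηc hηs, fun y ↦ hεu ?_⟩
  rw [dist_eq_norm]
  have hD : Real.sqrt (∫ v, ‖ξ v - η v‖ ^ 2) ≤ δ := by
    rw [Real.sqrt_le_left hδ0.le]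
    exact hηε
  have hB : Real.sqrt (∫ v, ‖η v‖ ^ 2) ≤ A + δ := by
    -- Minkowski: |‖ξ‖₂ − ‖η‖₂| ≤ ‖ξ − η‖₂
    have hm := abs_sqrt_integral_norm_sq_sub_le hξ hη2'
    have := (abs_sub_le_iff.1 hm).2
    linarith
  have h := norm_autocorr_sub_autocorr_le hξ hη2' y
  calc ‖weilConv ξ (weilReflect ξ) y - weilConv η (weilReflect η) y‖
      ≤ Real.sqrt (∫ v, ‖ξ v - η v‖ ^ 2) * (A + Real.sqrt (∫ v, ‖η v‖ ^ 2)) := h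
    _ ≤ δ * (A + (A + δ)) := by gcongr
    _ = δ * (2 * A + δ) := by ring
    _ < ε := hδε

/-! ## §3 The identity `Re Q = E_N` on the whole form domain -/

/-- RH-FREE.  A function supported in `[−a,a]` has `tsupport ⊆ [−a,a]`. -/
theorem tsupport_subset_Icc_of_support_subset (hs : Function.support ξ ⊆ Icc (-a) a) :
    tsupport ξ ⊆ Icc (-a) a :=
  closure_minimal hs isClosed_Icc

/-- RH-FREE.  A function supported in `[−a,a]` is compactly supported. -/
theorem hasCompactSupport_of_support_subset_Icc (hs : Function.support ξ ⊆ Icc (-a) a) : HasCompactSupport ξ :=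
  HasCompactSupport.intro isCompact_Icc fun _ hx ↦ Function.notMem_support.1 fun h ↦ hx (hs h)

/-- **RH-FREE · `Q(ξ) = E_{⌊e^{2a}⌋}(ξ)` ON THE WHOLE FORM DOMAIN** (as a complex number): for every
`ξ ∈ ConnesConsani2023.formDomain a` (square-integrable, supported in `[−a,a]`, finite log-Sobolev energy),
`weilQuadratic ξ = ↑(weilFinitePrimeQuadratic (primeCutoff a) ξ)`.  No positivity of `a` is needed. -/
theorem weilQuadratic_eq_weilFinitePrimeQuadratic_of_mem_formDomain (hξ : ξ ∈ formDomain a) :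
    weilQuadratic ξ = (weilFinitePrimeQuadratic (primeCutoff a) ξ : ℂ) := by
  have h1 : Integrable ξ := integrable_of_memLp_window hξ.1 hξ.2.1
  exact weilQuadratic_eq_weilFinitePrimeQuadratic_of_rough h1 hξ.1 (tsupport_subset_Icc_of_support_subset hξ.2.1)
    (hasCompactSupport_of_support_subset_Icc hξ.2.1) (continuous_autocorr_of_memLp hξ.1)
    (integrable_norm_sq_weilMellin_mul_reDigammaQuarter_of_energy h1 hξ.2.2)

/-- **RH-FREE · `Re Q(ξ) = E_{⌊e^{2a}⌋}(ξ)` on the whole form domain.** -/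
theorem re_weilQuadratic_eq_weilFinitePrimeQuadratic_of_mem_formDomain (hξ : ξ ∈ formDomain a) :
    (weilQuadratic ξ).re = weilFinitePrimeQuadratic (primeCutoff a) ξ := by
  rw [weilQuadratic_eq_weilFinitePrimeQuadratic_of_mem_formDomain hξ, Complex.ofReal_re]

/-- RH-FREE.  Weil's quadratic functional is REAL on the form domain. -/
theorem weilQuadratic_im_of_mem_formDomain (hξ : ξ ∈ formDomain a) : (weilQuadratic ξ).im = 0 := by
  rw [weilQuadratic_eq_weilFinitePrimeQuadratic_of_mem_formDomain hξ, Complex.ofReal_im]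

/-- **RH-FREE · K-B `FormIdentityOnDomain` (theory g10 round 2, by-product), VERBATIM**: for every `a > 0` and every
`ξ ∈ formDomain a`, `Re weilQuadratic ξ = weilFinitePrimeQuadratic (primeCutoff a) ξ`.  (The hypothesis `0 < a` is part of
the registered statement and is not used.) -/
theorem formIdentityOnDomain :
    ∀ a : ℝ, 0 < a → ∀ ξ : ℝ → ℂ, ξ ∈ Literature.NumberTheory.ConnesConsani2023.formDomain a →
      (Literature.NumberTheory.LFunctions.weilQuadratic ξ).re =
        Literature.NumberTheory.LFunctions.weilFinitePrimeQuadratic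
          (Literature.NumberTheory.ConnesConsani2023.primeCutoff a) ξ :=
  fun _ _ _ hξ ↦ re_weilQuadratic_eq_weilFinitePrimeQuadratic_of_mem_formDomain hξ

/-- **RH-FREE · CONNES–CONSANI'S EXTENDED FORM IS WEIL'S FUNCTIONAL WHEREVER IT IS FINITE**: on the form domain,
`semilocalWeilForm a ξ = Re Q(ξ)` (the tree's `semilocalWeilForm_eq_re_weilQuadratic` is the smooth case). -/
theorem semilocalWeilForm_eq_re_weilQuadratic_of_mem_formDomain (hξ : ξ ∈ formDomain a) :
    semilocalWeilForm a ξ = (((weilQuadratic ξ).re : ℝ) : EReal) := by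
  rw [semilocalWeilForm_of_mem_formDomain hξ, re_weilQuadratic_eq_weilFinitePrimeQuadratic_of_mem_formDomain hξ]

/-- RH-FREE.  Consequently the ground energy is coercive for `Re Q` itself on the whole form domain:
`ε(a)·‖ξ‖₂² ≤ Re Q(ξ)` for every `ξ ∈ formDomain a`, `a > 0` (rh-dbr-eng-5 g6's
`weilGroundEnergy_mul_le_weilFinitePrimeQuadratic` rewritten through the identity). -/
theorem weilGroundEnergy_mul_le_re_weilQuadratic_of_mem_formDomain (ha : 0 < a) (hξ : ξ ∈ formDomain a) :
    weilGroundEnergy a * ∫ x, ‖ξ x‖ ^ 2 ≤ (weilQuadratic ξ).re := by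
  rw [re_weilQuadratic_eq_weilFinitePrimeQuadratic_of_mem_formDomain hξ]
  exact weilGroundEnergy_mul_le_weilFinitePrimeQuadratic ha hξ

/-! ## §4 The θ-flow window outputs: CC's form and the dissipation identity -/

variable {θ t : ℝ} {f : ℝ → ℝ}

/-- RH-FREE.  On the window outputs `g_θ = winOut θ t f` (`t > 0`, `θ > 1`, `f ∈ L²(−t,t)`), CC's extended form is finite
and equals `Re Q(g_θ)`. -/
theorem semilocalWeilForm_winOut (ht : 0 < t) (hθ : 1 < θ) (hf : MemLp f 2 (winMeasure t)) :
    semilocalWeilForm t (winOut θ t f) = (((weilQuadratic (winOut θ t f)).re : ℝ) : EReal) :=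
  semilocalWeilForm_eq_re_weilQuadratic_of_mem_formDomain (winOut_mem_formDomain ht hθ hf)

/-- **RH-FREE · THE θ-FLOW DISSIPATES CONNES–CONSANI'S FORM**: for `θ > 1` and `f ∈ L²(−t,t)`,
`d/dθ ‖𝖪_θ[t]f‖² = −2·E_{⌊e^{2t}⌋}(g_θ)` — the flow identity (T0) (`thetaFlowIdentity`, [rh-dbr-eng] g6) with Weil's
functional replaced by Yoshida's analytic form through K2b (`re_weilQuadratic_winOut_eq_weilFinitePrimeQuadratic`).
No positivity of `t` is needed. -/
theorem hasDerivAt_winNormSq_weilFinitePrimeQuadratic (hθ : 1 < θ) (hf : MemLp f 2 (winMeasure t)) :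
    HasDerivAt (fun θ' : ℝ ↦ winNormSq (limKernel θ') t f)
      (-2 * weilFinitePrimeQuadratic (primeCutoff t) (winOut θ t f)) θ := by
  rw [← re_weilQuadratic_winOut_eq_weilFinitePrimeQuadratic hθ (integrableOn_of_memLp_winMeasure hf)]
  exact thetaFlowIdentity t θ hθ f hf

end Summit.RiemannHypothesis.RiemannHypothesis.Theorems.SuzukiThetaFlow

end
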